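import Summits.HodgeConjecture.HodgeConjecture.Theorems.SixfoldTableXCensusIsogeny
import Summits.HodgeConjecture.HodgeConjecture.Theorems.SixfoldTableXClasses
import Literature.AlgebraicGeometry.HodgeTheory.EllipticCurvePowersHodgeClasses
import Literature.AlgebraicGeometry.HodgeTheory.NonCMEllipticCurvesProductsHodgeClasses
import HarnessLib

/-!
# TABLE X (dimension 6) — the census nodes X2 / X1 DISCHARGED IN THE KERNEL on the elliptic-product rows
# (Tate–Murasaki–Imai `B = D`), unconditionally (cell `pub-hodgeav-hg6`, req-37 (A) Q2b; eng-2 g3)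

HONEST FRAMING. HC, `HC_AV` (stmt-1333), `HC_CM` (stmt-3052) and the rung H2 are NOT proved and do not occur here. The
census nodes `TableX.SixfoldCodimTwoCensus` (X2) / `TableX.SixfoldCodimThreeCensus` (X1) of `SixfoldTableXCover` are OURS
(`@[conjecture]`), never asserted. KERNEL ONLY: theorems over existing declarations; no definition, no `sorry`, no new
named fact; every input is a THEOREM of the tree (Tate–Murasaki `Bᵖ(Eⁿ) = Dᵖ(Eⁿ)` for EVERY complex elliptic curve:
`EllSlots.hodgeClasses_divisorial'`; Imai `B = D` for products of powers of pairwise non-isogenous curves without complex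
multiplication: `hodgeClasses_divisorial_multiPowSucc`; isogeny transport of the conclusions: L7b
`codimTwoCensusAt_iff_of_isIsogenous` / `codimThreeCensusAt_iff_of_isIsogenous`).

WHY THIS MODULE (census-node self-audit, a new axis «A7: a row VERIFIED in the kernel, not by dossier»). L7
(`SixfoldTableXClasses`) shows the class of the per-variety theorem L6 / of the census nodes, `dim A = 6 ∧ ¬ 𝒞 A`
(`𝒞` = CM ∪ K3-partner cell), is inhabited by `E × E⁵` for an elliptic curve `E` without complex multiplication; L7b
(`SixfoldTableXCensusIsogeny`) shows the nodes are statements about isogeny classes. Here the per-variety CONCLUSIONS of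
X2 and X1 are PROVED for that inhabitant and for its whole isogeny class — TABLE X row 28 (non-interacting products), the
pure elliptic power `E⁶`: every rational `(2,2)`- resp. `(3,3)`-class lies already in the FIRST summand (divisor monomials),
so the nodes hold there by the divisor summand alone. Hence the two `@[conjecture]` nodes are not only non-vacuous but
CONSISTENT WITH THE KERNEL on the exhibited inhabitant: no refutation of X2 / X1 can come from the isogeny class of
`E⁶` (any `E`), nor from the Imai rows `E₀^{a₀} × ⋯ × E_r^{a_r}` (pairwise non-isogenous curves without CM).

* §1 `codimTwoCensusAt_of_divisorial`, `codimThreeCensusAt_of_divisorial` (+ `…_of_isIsogenous_…`): any variety with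
  `Bᵖ = Dᵖ ⊗ ℂ` (`p = 2`, resp. `3`) satisfies the X2- (resp. X1-) conclusion, and so does everything isogenous to it.
* §2 `codimTwoCensusAt_of_ellSlots`, `codimThreeCensusAt_of_ellSlots`, `census_powSucc`, `census_multiPowSucc`: E-slot
  varieties (all bracketings of copies of ONE curve `E`, CM or not), the powers `E^{N+1}`, and the Imai products.
* §3 `census_of_isIsogenous_prod_powSucc_four`: for `E` NOT of CM type, every `A ∼ E × E⁵` is a sixfold OFF the residue
  class (L7) AND satisfies both conclusions; `sixfoldCensus_on_isogenyClass_prod_powSucc_four`: the nodes RESTRICTED to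
  that isogeny class hold; `exists_dim_six_offResidue_census`: an off-residue sixfold satisfying X2 ∧ X1 exists.
* §4 `hodgeConjectureFor_of_isIsogenous_prod_powSucc_four`: on this row the CONCLUSION of L6 (`HodgeConjectureFor`)
  holds with NO binder at all (floor row; the tree's Tate–Murasaki theorem) — consistent with TABLE X's «S-PRINT».

Nothing here is a corollary of `HC_CM`; no hypothesis of the cover is discharged GLOBALLY (X2 / X1 stay `@[conjecture]`:
they quantify over ALL off-residue sixfolds); typed ≠ proved.
-/

set_option linter.dupNamespace false

noncomputable section

open CategoryTheory
open Literature.AlgebraicGeometry Literature.AlgebraicGeometry.Motives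
open Literature.AlgebraicGeometry.Motives.AbelianVariety (IsIsogenous IsIsogeny)
open Literature.AlgebraicGeometry.HodgeTheory
open Literature.AlgebraicGeometry.Milne1999
open Literature.AlgebraicTopology.SingularHomology
open Literature.Barriers.HodgeConjecture
open Summit.HodgeConjecture.HodgeConjecture.Ring2.ClassTargets
open Summit.HodgeConjecture.HodgeConjecture.Ring2.Motiv (ProdCMCell)
open Summit.HodgeConjecture.HodgeConjecture.Ring2.Atlas (IsQuarticFieldTypeIVFourfold)

namespace Summit.HodgeConjecture.HodgeConjecture.TableX

/-! ## §1 `B = D` rows satisfy both census conclusions (divisor summand alone), and so do their isogeny classes -/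

/-- **A variety with `B² = D² ⊗ ℂ` satisfies the X2-conclusion**: if every rational `(2,2)`-class on `A` is a
`ℂ`-combination of products of two divisor classes, it lies a fortiori in `D²(A) ⊗ ℂ ⊔ (pull-backs from smaller
dimension)`. [cite: MoonenZarhin1999LowDim, §5 (5.1) and Cor. (3.9)] -/
theorem codimTwoCensusAt_of_divisorial {A : AbelianVariety ℂ}
    (hD : ∀ c : complexBetti A.X (2 * 2), IsRationalClass c → IsOfHodgeType A.dim A.X (2 * 2) 2 2 c →
      c ∈ divisorClassesSpan A.X A.dim 2) :
    ∀ c : complexBetti A.X (2 * 2), IsRationalClass c → IsOfHodgeType A.dim A.X (2 * 2) 2 2 c →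
      c ∈ divisorClassesSpan A.X A.dim 2 ⊔ Submodule.span ℂ {w' : complexBetti A.X (2 * 2) |
        ∃ (C : AbelianVariety ℂ) (g : A.X ⟶ C.X) (w : complexBetti C.X (2 * 2)), C.dim < A.dim ∧
          IsRationalClass w ∧ IsOfHodgeType C.dim C.X (2 * 2) 2 2 w ∧ w' = complexBetti.map g (2 * 2) w} :=
  fun c hcQ hcH ↦ Submodule.mem_sup_left (hD c hcQ hcH)

/-- **A variety with `B³ = D³ ⊗ ℂ` satisfies the X1-conclusion** (four summands; the first one suffices).
[cite: MoonenZarhin1999LowDim, §5 (5.1) and Cor. (3.9)] -/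
theorem codimThreeCensusAt_of_divisorial {A : AbelianVariety ℂ}
    (hD : ∀ c : complexBetti A.X (2 * 3), IsRationalClass c → IsOfHodgeType A.dim A.X (2 * 3) 3 3 c →
      c ∈ divisorClassesSpan A.X A.dim 3) :
    ∀ c : complexBetti A.X (2 * 3), IsRationalClass c → IsOfHodgeType A.dim A.X (2 * 3) 3 3 c →
      c ∈ divisorClassesSpan A.X A.dim 3 ⊔ Submodule.span ℂ {w' : complexBetti A.X (2 * 3) |
          ∃ (a : complexBetti A.X (2 * 2)) (b : complexBetti A.X (2 * 1)),
            IsRationalClass a ∧ IsOfHodgeType A.dim A.X (2 * 2) 2 2 a ∧ IsRationalClass b ∧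
            IsOfHodgeType A.dim A.X (2 * 1) 1 1 b ∧ w' = cupProduct (two_mul_add_two_mul 2 1) a b} ⊔
        Submodule.span ℂ {w' : complexBetti A.X (2 * 3) |
          ∃ (C : AbelianVariety ℂ) (g : A.X ⟶ C.X) (w : complexBetti C.X (2 * 3)), C.dim < A.dim ∧
            IsRationalClass w ∧ IsOfHodgeType C.dim C.X (2 * 3) 3 3 w ∧ w' = complexBetti.map g (2 * 3) w} ⊔
        Submodule.span ℂ {w' : complexBetti A.X (2 * 3) |
          ∃ (B' : AbelianVariety ℂ) (g : A.X ⟶ B'.X) (d : ℕ) (ψ : B' ⟶ B') (w : complexBetti B'.X (2 * 3)),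
            B'.dim = 6 ∧ 0 < d ∧ ψ ≫ ψ = -(d • 𝟙 B') ∧ IsRationalClass w ∧
            IsOfHodgeType B'.dim B'.X (2 * 3) 3 3 w ∧ w ∈ weilClassesOf B' ψ 3 d ∧
            w' = complexBetti.map g (2 * 3) w} :=
  fun c hcQ hcH ↦ Submodule.mem_sup_left (Submodule.mem_sup_left (Submodule.mem_sup_left (hD c hcQ hcH)))

/-- **Everything isogenous to a `B² = D² ⊗ ℂ` variety satisfies the X2-conclusion** (L7b transport).
[cite: vanGeemen1994HodgeAV, 3.6–3.7] [cite: MoonenZarhin1999LowDim, §5 (5.1)] -/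
theorem codimTwoCensusAt_of_isIsogenous_of_divisorial {A B : AbelianVariety ℂ} (hAB : IsIsogenous A B)
    (hD : ∀ c : complexBetti B.X (2 * 2), IsRationalClass c → IsOfHodgeType B.dim B.X (2 * 2) 2 2 c →
      c ∈ divisorClassesSpan B.X B.dim 2) :
    ∀ c : complexBetti A.X (2 * 2), IsRationalClass c → IsOfHodgeType A.dim A.X (2 * 2) 2 2 c →
      c ∈ divisorClassesSpan A.X A.dim 2 ⊔ Submodule.span ℂ {w' : complexBetti A.X (2 * 2) |
        ∃ (C : AbelianVariety ℂ) (g : A.X ⟶ C.X) (w : complexBetti C.X (2 * 2)), C.dim < A.dim ∧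
          IsRationalClass w ∧ IsOfHodgeType C.dim C.X (2 * 2) 2 2 w ∧ w' = complexBetti.map g (2 * 2) w} :=
  (codimTwoCensusAt_iff_of_isIsogenous hAB).mpr (codimTwoCensusAt_of_divisorial hD)

/-- **Everything isogenous to a `B³ = D³ ⊗ ℂ` variety satisfies the X1-conclusion** (L7b transport).
[cite: vanGeemen1994HodgeAV, 3.6–3.7] [cite: MoonenZarhin1999LowDim, §5 (5.1)] -/
theorem codimThreeCensusAt_of_isIsogenous_of_divisorial {A B : AbelianVariety ℂ} (hAB : IsIsogenous A B)
    (hD : ∀ c : complexBetti B.X (2 * 3), IsRationalClass c → IsOfHodgeType B.dim B.X (2 * 3) 3 3 c →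
      c ∈ divisorClassesSpan B.X B.dim 3) :
    ∀ c : complexBetti A.X (2 * 3), IsRationalClass c → IsOfHodgeType A.dim A.X (2 * 3) 3 3 c →
      c ∈ divisorClassesSpan A.X A.dim 3 ⊔ Submodule.span ℂ {w' : complexBetti A.X (2 * 3) |
          ∃ (a : complexBetti A.X (2 * 2)) (b : complexBetti A.X (2 * 1)),
            IsRationalClass a ∧ IsOfHodgeType A.dim A.X (2 * 2) 2 2 a ∧ IsRationalClass b ∧
            IsOfHodgeType A.dim A.X (2 * 1) 1 1 b ∧ w' = cupProduct (two_mul_add_two_mul 2 1) a b} ⊔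
        Submodule.span ℂ {w' : complexBetti A.X (2 * 3) |
          ∃ (C : AbelianVariety ℂ) (g : A.X ⟶ C.X) (w : complexBetti C.X (2 * 3)), C.dim < A.dim ∧
            IsRationalClass w ∧ IsOfHodgeType C.dim C.X (2 * 3) 3 3 w ∧ w' = complexBetti.map g (2 * 3) w} ⊔
        Submodule.span ℂ {w' : complexBetti A.X (2 * 3) |
          ∃ (B' : AbelianVariety ℂ) (g : A.X ⟶ B'.X) (d : ℕ) (ψ : B' ⟶ B') (w : complexBetti B'.X (2 * 3)),
            B'.dim = 6 ∧ 0 < d ∧ ψ ≫ ψ = -(d • 𝟙 B') ∧ IsRationalClass w ∧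
            IsOfHodgeType B'.dim B'.X (2 * 3) 3 3 w ∧ w ∈ weilClassesOf B' ψ 3 d ∧
            w' = complexBetti.map g (2 * 3) w} :=
  (codimThreeCensusAt_iff_of_isIsogenous hAB).mpr (codimThreeCensusAt_of_divisorial hD)

/-! ## §2 E-slot varieties, elliptic powers and Imai products -/

/-- **Every variety with an `E`-slot structure (`E` ANY complex elliptic curve: all bracketings of products of copies
of `E`) satisfies the X2-conclusion** — Tate–Murasaki `B² = D² ⊗ ℂ` (`EllSlots.hodgeClasses_divisorial'`).
[cite: vanGeemen1994HodgeAV, Thm. 4.3] [cite: Gordon1997, §3 (Tate; Murasaki [B.80])] [cite: MoonenZarhin1999LowDim, Cor. 3.9] -/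
theorem codimTwoCensusAt_of_ellSlots {E B : AbelianVariety ℂ} {n : ℕ} {g : Fin n → (B ⟶ E)} (hE : E.dim = 1)
    (hg : EllSlots E B g) :
    ∀ c : complexBetti B.X (2 * 2), IsRationalClass c → IsOfHodgeType B.dim B.X (2 * 2) 2 2 c →
      c ∈ divisorClassesSpan B.X B.dim 2 ⊔ Submodule.span ℂ {w' : complexBetti B.X (2 * 2) |
        ∃ (C : AbelianVariety ℂ) (g : B.X ⟶ C.X) (w : complexBetti C.X (2 * 2)), C.dim < B.dim ∧
          IsRationalClass w ∧ IsOfHodgeType C.dim C.X (2 * 2) 2 2 w ∧ w' = complexBetti.map g (2 * 2) w} :=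
  codimTwoCensusAt_of_divisorial fun c hcQ hcH ↦ hg.hodgeClasses_divisorial' hE 2 c hcQ hcH

/-- **Every variety with an `E`-slot structure satisfies the X1-conclusion** (`B³ = D³ ⊗ ℂ`).
[cite: vanGeemen1994HodgeAV, Thm. 4.3] [cite: Gordon1997, §3 (Tate; Murasaki [B.80])] [cite: MoonenZarhin1999LowDim, Cor. 3.9] -/
theorem codimThreeCensusAt_of_ellSlots {E B : AbelianVariety ℂ} {n : ℕ} {g : Fin n → (B ⟶ E)} (hE : E.dim = 1)
    (hg : EllSlots E B g) :
    ∀ c : complexBetti B.X (2 * 3), IsRationalClass c → IsOfHodgeType B.dim B.X (2 * 3) 3 3 c →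
      c ∈ divisorClassesSpan B.X B.dim 3 ⊔ Submodule.span ℂ {w' : complexBetti B.X (2 * 3) |
          ∃ (a : complexBetti B.X (2 * 2)) (b : complexBetti B.X (2 * 1)),
            IsRationalClass a ∧ IsOfHodgeType B.dim B.X (2 * 2) 2 2 a ∧ IsRationalClass b ∧
            IsOfHodgeType B.dim B.X (2 * 1) 1 1 b ∧ w' = cupProduct (two_mul_add_two_mul 2 1) a b} ⊔
        Submodule.span ℂ {w' : complexBetti B.X (2 * 3) |
          ∃ (C : AbelianVariety ℂ) (g : B.X ⟶ C.X) (w : complexBetti C.X (2 * 3)), C.dim < B.dim ∧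
            IsRationalClass w ∧ IsOfHodgeType C.dim C.X (2 * 3) 3 3 w ∧ w' = complexBetti.map g (2 * 3) w} ⊔
        Submodule.span ℂ {w' : complexBetti B.X (2 * 3) |
          ∃ (B' : AbelianVariety ℂ) (g : B.X ⟶ B'.X) (d : ℕ) (ψ : B' ⟶ B') (w : complexBetti B'.X (2 * 3)),
            B'.dim = 6 ∧ 0 < d ∧ ψ ≫ ψ = -(d • 𝟙 B') ∧ IsRationalClass w ∧
            IsOfHodgeType B'.dim B'.X (2 * 3) 3 3 w ∧ w ∈ weilClassesOf B' ψ 3 d ∧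
            w' = complexBetti.map g (2 * 3) w} :=
  codimThreeCensusAt_of_divisorial fun c hcQ hcH ↦ hg.hodgeClasses_divisorial' hE 3 c hcQ hcH

/-- **Both census conclusions on every variety isogenous to a power `E^{N+1}` of ANY complex elliptic curve** (in
particular on the pure powers `E⁶ = E.powSucc 5`, TABLE X row 28). [cite: vanGeemen1994HodgeAV, Lemma 3.7 and Thm. 4.3]
[cite: Gordon1997, §3 (Tate; Murasaki [B.80])] [cite: MoonenZarhin1999LowDim, §5 (5.1) and Cor. 3.9] -/
theorem census_of_isIsogenous_powSucc {E A : AbelianVariety ℂ} (hE : E.dim = 1) (N : ℕ)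
    (hA : IsIsogenous A (E.powSucc N)) :
    (∀ c : complexBetti A.X (2 * 2), IsRationalClass c → IsOfHodgeType A.dim A.X (2 * 2) 2 2 c →
      c ∈ divisorClassesSpan A.X A.dim 2 ⊔ Submodule.span ℂ {w' : complexBetti A.X (2 * 2) |
        ∃ (C : AbelianVariety ℂ) (g : A.X ⟶ C.X) (w : complexBetti C.X (2 * 2)), C.dim < A.dim ∧
          IsRationalClass w ∧ IsOfHodgeType C.dim C.X (2 * 2) 2 2 w ∧ w' = complexBetti.map g (2 * 2) w}) ∧
    (∀ c : complexBetti A.X (2 * 3), IsRationalClass c → IsOfHodgeType A.dim A.X (2 * 3) 3 3 c →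
      c ∈ divisorClassesSpan A.X A.dim 3 ⊔ Submodule.span ℂ {w' : complexBetti A.X (2 * 3) |
          ∃ (a : complexBetti A.X (2 * 2)) (b : complexBetti A.X (2 * 1)),
            IsRationalClass a ∧ IsOfHodgeType A.dim A.X (2 * 2) 2 2 a ∧ IsRationalClass b ∧
            IsOfHodgeType A.dim A.X (2 * 1) 1 1 b ∧ w' = cupProduct (two_mul_add_two_mul 2 1) a b} ⊔
        Submodule.span ℂ {w' : complexBetti A.X (2 * 3) |
          ∃ (C : AbelianVariety ℂ) (g : A.X ⟶ C.X) (w : complexBetti C.X (2 * 3)), C.dim < A.dim ∧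
            IsRationalClass w ∧ IsOfHodgeType C.dim C.X (2 * 3) 3 3 w ∧ w' = complexBetti.map g (2 * 3) w} ⊔
        Submodule.span ℂ {w' : complexBetti A.X (2 * 3) |
          ∃ (B' : AbelianVariety ℂ) (g : A.X ⟶ B'.X) (d : ℕ) (ψ : B' ⟶ B') (w : complexBetti B'.X (2 * 3)),
            B'.dim = 6 ∧ 0 < d ∧ ψ ≫ ψ = -(d • 𝟙 B') ∧ IsRationalClass w ∧
            IsOfHodgeType B'.dim B'.X (2 * 3) 3 3 w ∧ w ∈ weilClassesOf B' ψ 3 d ∧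
            w' = complexBetti.map g (2 * 3) w}) :=
  ⟨codimTwoCensusAt_of_isIsogenous_of_divisorial hA
      fun c hcQ hcH ↦ EllipticCurve.hodgeClasses_divisorial_powSucc hE N 2 c hcQ hcH,
    codimThreeCensusAt_of_isIsogenous_of_divisorial hA
      fun c hcQ hcH ↦ EllipticCurve.hodgeClasses_divisorial_powSucc hE N 3 c hcQ hcH⟩

/-- **Both census conclusions on every variety isogenous to an Imai product `E₀^{N₀+1} × ⋯ × E_r^{N_r+1}`**, the `E_i`
elliptic curves WITHOUT complex multiplication (`HodgeEndTrivial`) and pairwise not Hodge-isogenous (TABLE X row 28,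
non-interacting products of type-I(1) curves; Imai `B = D`, `hodgeClasses_divisorial_multiPowSucc`).
[cite: Gordon1997, §3 (Theorem)] [cite: MoonenZarhin1999LowDim, Cor. (3.9) and §5 (5.1)] [cite: vanGeemen1994HodgeAV, Lemma 3.7] -/
theorem census_of_isIsogenous_multiPowSucc (r : ℕ) (E : Fin (r + 1) → AbelianVariety ℂ) (N : Fin (r + 1) → ℕ)
    (hE : ∀ i, (E i).dim = 1) (hT : ∀ i, EllipticCurve.HodgeEndTrivial (E i))
    (hni : ∀ i k, i ≠ k → ¬ EllipticCurve.HodgeIsogenous (E i) (E k)) {A : AbelianVariety ℂ}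
    (hA : IsIsogenous A (multiPowSucc r E N)) :
    (∀ c : complexBetti A.X (2 * 2), IsRationalClass c → IsOfHodgeType A.dim A.X (2 * 2) 2 2 c →
      c ∈ divisorClassesSpan A.X A.dim 2 ⊔ Submodule.span ℂ {w' : complexBetti A.X (2 * 2) |
        ∃ (C : AbelianVariety ℂ) (g : A.X ⟶ C.X) (w : complexBetti C.X (2 * 2)), C.dim < A.dim ∧
          IsRationalClass w ∧ IsOfHodgeType C.dim C.X (2 * 2) 2 2 w ∧ w' = complexBetti.map g (2 * 2) w}) ∧
    (∀ c : complexBetti A.X (2 * 3), IsRationalClass c → IsOfHodgeType A.dim A.X (2 * 3) 3 3 c →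
      c ∈ divisorClassesSpan A.X A.dim 3 ⊔ Submodule.span ℂ {w' : complexBetti A.X (2 * 3) |
          ∃ (a : complexBetti A.X (2 * 2)) (b : complexBetti A.X (2 * 1)),
            IsRationalClass a ∧ IsOfHodgeType A.dim A.X (2 * 2) 2 2 a ∧ IsRationalClass b ∧
            IsOfHodgeType A.dim A.X (2 * 1) 1 1 b ∧ w' = cupProduct (two_mul_add_two_mul 2 1) a b} ⊔
        Submodule.span ℂ {w' : complexBetti A.X (2 * 3) |
          ∃ (C : AbelianVariety ℂ) (g : A.X ⟶ C.X) (w : complexBetti C.X (2 * 3)), C.dim < A.dim ∧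
            IsRationalClass w ∧ IsOfHodgeType C.dim C.X (2 * 3) 3 3 w ∧ w' = complexBetti.map g (2 * 3) w} ⊔
        Submodule.span ℂ {w' : complexBetti A.X (2 * 3) |
          ∃ (B' : AbelianVariety ℂ) (g : A.X ⟶ B'.X) (d : ℕ) (ψ : B' ⟶ B') (w : complexBetti B'.X (2 * 3)),
            B'.dim = 6 ∧ 0 < d ∧ ψ ≫ ψ = -(d • 𝟙 B') ∧ IsRationalClass w ∧
            IsOfHodgeType B'.dim B'.X (2 * 3) 3 3 w ∧ w ∈ weilClassesOf B' ψ 3 d ∧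
            w' = complexBetti.map g (2 * 3) w}) :=
  ⟨codimTwoCensusAt_of_isIsogenous_of_divisorial hA
      fun c hcQ hcH ↦ hodgeClasses_divisorial_multiPowSucc r E N hE hT hni 2 c hcQ hcH,
    codimThreeCensusAt_of_isIsogenous_of_divisorial hA
      fun c hcQ hcH ↦ hodgeClasses_divisorial_multiPowSucc r E N hE hT hni 3 c hcQ hcH⟩

/-! ## §3 The row of L7's inhabitant `E × E⁵`: inside L6's class AND satisfying X2 ∧ X1 -/

/-- **TABLE X row 28 (pure elliptic power), KERNEL VERDICT.** For an elliptic curve `E` NOT of CM type and every complex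
abelian variety `A` isogenous to `E × E⁵`: `dim A = 6`, `A` is OFF the residue class `𝒞` = CM ∪ K3-partner cell (L7:
`offResidueSix_iff_of_isIsogenous`, `not_residueClass_prod_powSucc_four_of_not_isOfCMType`) — so `A` is in the domain
of the census nodes —, AND both census conclusions hold at `A` (Tate–Murasaki through the `E`-slot structure of
`E × E⁵`, transported along the isogeny). [cite: vanGeemen1994HodgeAV, Lemma 3.7 and Thm. 4.3]
[cite: Gordon1997, §3 (Tate; Murasaki [B.80])] [cite: MoonenZarhin1999LowDim, §2 Type I(1), §5 (5.1), Cor. 3.9]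
[cite: Milne1986AbelianVarieties, §12 p. 122] -/
theorem census_of_isIsogenous_prod_powSucc_four {E A : AbelianVariety ℂ} (hE : E.dim = 1) (hEcm : ¬ IsOfCMType E)
    (hA : IsIsogenous A (E.prod (E.powSucc 4))) :
    (A.dim = 6 ∧ ¬ (IsOfCMType A ∨ ProdCMCell IsQuarticFieldTypeIVFourfold (fun Z ↦ Z.dim = 2) A)) ∧
    (∀ c : complexBetti A.X (2 * 2), IsRationalClass c → IsOfHodgeType A.dim A.X (2 * 2) 2 2 c →
      c ∈ divisorClassesSpan A.X A.dim 2 ⊔ Submodule.span ℂ {w' : complexBetti A.X (2 * 2) |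
        ∃ (C : AbelianVariety ℂ) (g : A.X ⟶ C.X) (w : complexBetti C.X (2 * 2)), C.dim < A.dim ∧
          IsRationalClass w ∧ IsOfHodgeType C.dim C.X (2 * 2) 2 2 w ∧ w' = complexBetti.map g (2 * 2) w}) ∧
    (∀ c : complexBetti A.X (2 * 3), IsRationalClass c → IsOfHodgeType A.dim A.X (2 * 3) 3 3 c →
      c ∈ divisorClassesSpan A.X A.dim 3 ⊔ Submodule.span ℂ {w' : complexBetti A.X (2 * 3) |
          ∃ (a : complexBetti A.X (2 * 2)) (b : complexBetti A.X (2 * 1)),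
            IsRationalClass a ∧ IsOfHodgeType A.dim A.X (2 * 2) 2 2 a ∧ IsRationalClass b ∧
            IsOfHodgeType A.dim A.X (2 * 1) 1 1 b ∧ w' = cupProduct (two_mul_add_two_mul 2 1) a b} ⊔
        Submodule.span ℂ {w' : complexBetti A.X (2 * 3) |
          ∃ (C : AbelianVariety ℂ) (g : A.X ⟶ C.X) (w : complexBetti C.X (2 * 3)), C.dim < A.dim ∧
            IsRationalClass w ∧ IsOfHodgeType C.dim C.X (2 * 3) 3 3 w ∧ w' = complexBetti.map g (2 * 3) w} ⊔
        Submodule.span ℂ {w' : complexBetti A.X (2 * 3) |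
          ∃ (B' : AbelianVariety ℂ) (g : A.X ⟶ B'.X) (d : ℕ) (ψ : B' ⟶ B') (w : complexBetti B'.X (2 * 3)),
            B'.dim = 6 ∧ 0 < d ∧ ψ ≫ ψ = -(d • 𝟙 B') ∧ IsRationalClass w ∧
            IsOfHodgeType B'.dim B'.X (2 * 3) 3 3 w ∧ w ∈ weilClassesOf B' ψ 3 d ∧
            w' = complexBetti.map g (2 * 3) w}) := by
  have hslots := (ellSlots_self hE).prod (EllSlots.powSucc hE 4)
  refine ⟨(offResidueSix_iff_of_isIsogenous hA).mpr
      ⟨dim_prod_powSucc_four hE, not_residueClass_prod_powSucc_four_of_not_isOfCMType hE hEcm⟩, ?_, ?_⟩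
  · exact codimTwoCensusAt_of_isIsogenous_of_divisorial hA
      fun c hcQ hcH ↦ hslots.hodgeClasses_divisorial' hE 2 c hcQ hcH
  · exact codimThreeCensusAt_of_isIsogenous_of_divisorial hA
      fun c hcQ hcH ↦ hslots.hodgeClasses_divisorial' hE 3 c hcQ hcH

/-- **The census nodes RESTRICTED TO THE ISOGENY CLASS OF `E × E⁵` HOLD** (`E` any complex elliptic curve; the
restriction of X2 ∧ X1 to `{A : dim A = 6, ¬ 𝒞 A, A ∼ E × E⁵}` is a theorem of the tree, whatever the CM status of
`E` — for CM `E` the class is empty of off-residue members anyway). [cite: vanGeemen1994HodgeAV, Lemma 3.7 and Thm. 4.3]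
[cite: MoonenZarhin1999LowDim, §5 (5.1), Cor. 3.9] -/
theorem sixfoldCensus_on_isogenyClass_prod_powSucc_four {E : AbelianVariety ℂ} (hE : E.dim = 1) :
    ∀ A : AbelianVariety ℂ, A.dim = 6 →
      ¬ (IsOfCMType A ∨ ProdCMCell IsQuarticFieldTypeIVFourfold (fun Z ↦ Z.dim = 2) A) →
      IsIsogenous A (E.prod (E.powSucc 4)) →
    (∀ c : complexBetti A.X (2 * 2), IsRationalClass c → IsOfHodgeType A.dim A.X (2 * 2) 2 2 c →
      c ∈ divisorClassesSpan A.X A.dim 2 ⊔ Submodule.span ℂ {w' : complexBetti A.X (2 * 2) |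
        ∃ (C : AbelianVariety ℂ) (g : A.X ⟶ C.X) (w : complexBetti C.X (2 * 2)), C.dim < A.dim ∧
          IsRationalClass w ∧ IsOfHodgeType C.dim C.X (2 * 2) 2 2 w ∧ w' = complexBetti.map g (2 * 2) w}) ∧
    (∀ c : complexBetti A.X (2 * 3), IsRationalClass c → IsOfHodgeType A.dim A.X (2 * 3) 3 3 c →
      c ∈ divisorClassesSpan A.X A.dim 3 ⊔ Submodule.span ℂ {w' : complexBetti A.X (2 * 3) |
          ∃ (a : complexBetti A.X (2 * 2)) (b : complexBetti A.X (2 * 1)),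
            IsRationalClass a ∧ IsOfHodgeType A.dim A.X (2 * 2) 2 2 a ∧ IsRationalClass b ∧
            IsOfHodgeType A.dim A.X (2 * 1) 1 1 b ∧ w' = cupProduct (two_mul_add_two_mul 2 1) a b} ⊔
        Submodule.span ℂ {w' : complexBetti A.X (2 * 3) |
          ∃ (C : AbelianVariety ℂ) (g : A.X ⟶ C.X) (w : complexBetti C.X (2 * 3)), C.dim < A.dim ∧
            IsRationalClass w ∧ IsOfHodgeType C.dim C.X (2 * 3) 3 3 w ∧ w' = complexBetti.map g (2 * 3) w} ⊔
        Submodule.span ℂ {w' : complexBetti A.X (2 * 3) |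
          ∃ (B' : AbelianVariety ℂ) (g : A.X ⟶ B'.X) (d : ℕ) (ψ : B' ⟶ B') (w : complexBetti B'.X (2 * 3)),
            B'.dim = 6 ∧ 0 < d ∧ ψ ≫ ψ = -(d • 𝟙 B') ∧ IsRationalClass w ∧
            IsOfHodgeType B'.dim B'.X (2 * 3) 3 3 w ∧ w ∈ weilClassesOf B' ψ 3 d ∧
            w' = complexBetti.map g (2 * 3) w}) := by
  intro A _ _ hA
  have hslots := (ellSlots_self hE).prod (EllSlots.powSucc hE 4)
  exact ⟨codimTwoCensusAt_of_isIsogenous_of_divisorial hA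
      fun c hcQ hcH ↦ hslots.hodgeClasses_divisorial' hE 2 c hcQ hcH,
    codimThreeCensusAt_of_isIsogenous_of_divisorial hA
      fun c hcQ hcH ↦ hslots.hodgeClasses_divisorial' hE 3 c hcQ hcH⟩

/-- **AN OFF-RESIDUE SIXFOLD SATISFYING BOTH CENSUS CONCLUSIONS EXISTS, UNCONDITIONALLY**: `E × E⁵` for the tree's
elliptic curve without complex multiplication (`NonCMCurve.exists_ellipticCurve_not_isOfCMType`). So the very
inhabitant by which L7 shows the class of the census nodes non-empty VERIFIES the nodes in the kernel: X2 / X1 cannot be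
refuted on it (nor anywhere in its isogeny class, `sixfoldCensus_on_isogenyClass_prod_powSucc_four`).
[cite: MoonenZarhin1999LowDim, §2 (g = 1) Type I(1), Cor. 3.9] [cite: Gordon1997, §3 (Tate; Murasaki [B.80])]
[cite: Milne1986AbelianVarieties, §12 p. 122] -/
theorem exists_dim_six_offResidue_census :
    ∃ A : AbelianVariety ℂ, A.dim = 6 ∧
      ¬ (IsOfCMType A ∨ ProdCMCell IsQuarticFieldTypeIVFourfold (fun Z ↦ Z.dim = 2) A) ∧
    (∀ c : complexBetti A.X (2 * 2), IsRationalClass c → IsOfHodgeType A.dim A.X (2 * 2) 2 2 c →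
      c ∈ divisorClassesSpan A.X A.dim 2 ⊔ Submodule.span ℂ {w' : complexBetti A.X (2 * 2) |
        ∃ (C : AbelianVariety ℂ) (g : A.X ⟶ C.X) (w : complexBetti C.X (2 * 2)), C.dim < A.dim ∧
          IsRationalClass w ∧ IsOfHodgeType C.dim C.X (2 * 2) 2 2 w ∧ w' = complexBetti.map g (2 * 2) w}) ∧
    (∀ c : complexBetti A.X (2 * 3), IsRationalClass c → IsOfHodgeType A.dim A.X (2 * 3) 3 3 c →
      c ∈ divisorClassesSpan A.X A.dim 3 ⊔ Submodule.span ℂ {w' : complexBetti A.X (2 * 3) |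
          ∃ (a : complexBetti A.X (2 * 2)) (b : complexBetti A.X (2 * 1)),
            IsRationalClass a ∧ IsOfHodgeType A.dim A.X (2 * 2) 2 2 a ∧ IsRationalClass b ∧
            IsOfHodgeType A.dim A.X (2 * 1) 1 1 b ∧ w' = cupProduct (two_mul_add_two_mul 2 1) a b} ⊔
        Submodule.span ℂ {w' : complexBetti A.X (2 * 3) |
          ∃ (C : AbelianVariety ℂ) (g : A.X ⟶ C.X) (w : complexBetti C.X (2 * 3)), C.dim < A.dim ∧
            IsRationalClass w ∧ IsOfHodgeType C.dim C.X (2 * 3) 3 3 w ∧ w' = complexBetti.map g (2 * 3) w} ⊔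
        Submodule.span ℂ {w' : complexBetti A.X (2 * 3) |
          ∃ (B' : AbelianVariety ℂ) (g : A.X ⟶ B'.X) (d : ℕ) (ψ : B' ⟶ B') (w : complexBetti B'.X (2 * 3)),
            B'.dim = 6 ∧ 0 < d ∧ ψ ≫ ψ = -(d • 𝟙 B') ∧ IsRationalClass w ∧
            IsOfHodgeType B'.dim B'.X (2 * 3) 3 3 w ∧ w ∈ weilClassesOf B' ψ 3 d ∧
            w' = complexBetti.map g (2 * 3) w}) := by
  obtain ⟨E, hE1, -, -, hEcm⟩ := NonCMCurve.exists_ellipticCurve_not_isOfCMType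
  obtain ⟨⟨h6, hoff⟩, h2, h3⟩ := census_of_isIsogenous_prod_powSucc_four hE1 hEcm
    (AbelianVariety.IsIsogenous.refl (E.prod (E.powSucc 4)))
  exact ⟨E.prod (E.powSucc 4), h6, hoff, h2, h3⟩

/-! ## §4 On this row L6's conclusion needs no binder -/

/-- **FLOOR ROW.** On the isogeny class of `E × E⁵` (`E` ANY complex elliptic curve) the CONCLUSION of the per-variety
theorem L6, `HodgeConjectureFor A.dim A.X`, is an unconditional theorem of the tree (Tate–Murasaki up to isogeny,
`EllSlots.hodgeConjectureFor_of_isIsogenous'`): none of L6's binders (Markman₄, Markman₆, R-W6, X2, X1) is exercised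
on TABLE X row 28's pure elliptic power — consistent with its verdict «S-PRINT». Nothing beyond this instance.
[cite: vanGeemen1994HodgeAV, Lemma 3.7 and Thm. 4.3] [cite: Gordon1997, §3] [cite: Deligne2000, §1] -/
theorem hodgeConjectureFor_of_isIsogenous_prod_powSucc_four {E A : AbelianVariety ℂ} (hE : E.dim = 1)
    (hA : IsIsogenous A (E.prod (E.powSucc 4))) : HodgeConjectureFor A.dim A.X :=
  ((ellSlots_self hE).prod (EllSlots.powSucc hE 4)).hodgeConjectureFor_of_isIsogenous' hE hA

end Summit.HodgeConjecture.HodgeConjecture.TableX
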